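import Literature.AlgebraicGeometry.Frobenioids.MotivatingExamplesSub
import HarnessLib

/-!
# Frobenioids I, Theorem 6.4 (ii): the degree relation implies the order-compatibility (sub-DAG row T64ii/L02,
# converse bookkeeping), at the SCHEMA level

Mochizuki, *The geometry of Frobenioids I: the general theory*, Kyushu J. Math. **62** (2008) 293–400, §6,
Theorem 6.4 (ii), kurims text p. 114 ("the composite of `δ_{A₂}` with the isomorphism `Pic_Φ(A₁) ⥲ Pic_Φ(A₂)` … is
equal to `deg(Ψ^rlf) · δ_{A₁}`") and its proof p. 115 l. 34 – p. 116 l. 1 ("is compatible with the 'order structure'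
induced on both sides [via `δ_{A₁}`, `δ_{A₂}`] by the 'order structure' of `ℝ`") [cite: MochizukiFrdI2008, Thm. 6.4 (ii) p.115].

PROOF-ONLY file (cell abc-iut, sub-DAG `plan/L1/SUBDAG-FrdI-Thm64.md` row T64ii/L02; seat abc-iut-w4-d086; no
definitions).  The sub-DAG row L02 ⟹ (ii) (abc-iut-L1-t1's `Thm64ii_of_orderCompat`, discharged by abc-iut-L6-t10's
`Thm64ii_of_orderCompat_holds`) has the trivial CONVERSE recorded here over abc-iut-L1-t3's schema
`ArithRealification` / `Thm64ii` / `Thm64iiDeg` and abc-iut-L1-t1's `Thm64ii_L02_orderCompat`: once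
`δ_{Ψ A} ∘ picMap_A = deg · δ_A` with `deg > 0`, the composite `δ_{Ψ A} ∘ picMap_A ∘ δ_A⁻¹ = deg · (−)` is monotone.  So at
any data where the degree relation is proved for THE induced `picMap` (at THE realified arithmetic Frobenioids:
abc-iut-w4-d086's `ArithFrd.exists_picMap_thm64ii`, `ArithmeticFrobenioidThm64iiAtData.lean`), the order-compatibility
row holds for that same `picMap` by `Thm64ii_L02_orderCompat_of_thm64ii`.  (The universal closures of both schema
letters over a FREE `picMap` are false — replace `picMap` by `-picMap`; the content is in WHICH `picMap`.)
Nothing here is specific to the abc programme or bears on [IUTchIII] Cor. 3.12; no statement of the paper is strengthened.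
-/

noncomputable section

namespace Literature.AlgebraicGeometry.Frobenioids

open CategoryTheory

universe u v

variable {F₁ : Type} [Field F₁] {K₁ : Type} [Field K₁] [Algebra F₁ K₁]
  {F₂ : Type} [Field F₂] {K₂ : Type} [Field K₂] [Algebra F₂ K₂]
  {Rlf₁ : Type u} [Category.{v} Rlf₁] {Rlf₂ : Type u} [Category.{v} Rlf₂]
  (R₁ : ArithRealification (F := F₁) (K := K₁) Rlf₁) (R₂ : ArithRealification (F := F₂) (K := K₂) Rlf₂)

/-- **T64ii/L02 from the degree relation with a given degree**: if `δ_{Ψ A} ∘ picMap_A = deg · δ_A` for all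
Frobenius-trivial `A` with `deg > 0` (`Thm64iiDeg … deg`), then `δ_{Ψ A} ∘ picMap_A ∘ δ_A⁻¹ : ℝ → ℝ` is monotone for every
such `A` (`Thm64ii_L02_orderCompat`). [cite: MochizukiFrdI2008, Thm. 6.4 (ii) p.115] -/
theorem Thm64ii_L02_orderCompat_of_thm64iiDeg (Ψ : Rlf₁ ≌ Rlf₂)
    (picMap : ∀ A : Rlf₁, R₁.Pic A ≃+ R₂.Pic (Ψ.functor.obj A)) {deg : ℝ} (h : Thm64iiDeg R₁ R₂ Ψ picMap deg) :
    Thm64ii_L02_orderCompat R₁ R₂ Ψ picMap := by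
  obtain ⟨hdeg, hδ⟩ := h
  intro A hA hA' s t hst
  show R₂.δ _ hA' (picMap A ((R₁.δ A hA).symm s)) ≤ R₂.δ _ hA' (picMap A ((R₁.δ A hA).symm t))
  rw [hδ A hA hA', hδ A hA hA', (R₁.δ A hA).apply_symm_apply, (R₁.δ A hA).apply_symm_apply]
  exact mul_le_mul_of_nonneg_left hst hdeg.le

/-- **T64ii/L02 from (ii)**: `Thm64ii R₁ R₂ Ψ picMap → Thm64ii_L02_orderCompat R₁ R₂ Ψ picMap` — "compatible with the
'order structure' of `ℝ`" follows from the degree relation. [cite: MochizukiFrdI2008, Thm. 6.4 (ii) p.115] -/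
theorem Thm64ii_L02_orderCompat_of_thm64ii (Ψ : Rlf₁ ≌ Rlf₂)
    (picMap : ∀ A : Rlf₁, R₁.Pic A ≃+ R₂.Pic (Ψ.functor.obj A)) (h : Thm64ii R₁ R₂ Ψ picMap) :
    Thm64ii_L02_orderCompat R₁ R₂ Ψ picMap := by
  obtain ⟨deg, hdeg⟩ := h
  exact Thm64ii_L02_orderCompat_of_thm64iiDeg R₁ R₂ Ψ picMap hdeg

/-- The uniformity premise of `Thm64ii_of_orderCompat` (T64ii/L04: the composites `δ_{Ψ A} ∘ picMap_A ∘ δ_A⁻¹` do not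
depend on `A`) likewise follows from the degree relation with ONE `deg`. [cite: MochizukiFrdI2008, Thm. 6.4 (ii) p.114] -/
theorem Thm64ii_L04_uniform_of_thm64iiDeg (Ψ : Rlf₁ ≌ Rlf₂)
    (picMap : ∀ A : Rlf₁, R₁.Pic A ≃+ R₂.Pic (Ψ.functor.obj A)) {deg : ℝ} (h : Thm64iiDeg R₁ R₂ Ψ picMap deg) :
    ∀ (A B : Rlf₁) (hA : R₁.ops.IsFrobeniusTrivial A) (hA' : R₂.ops.IsFrobeniusTrivial (Ψ.functor.obj A))
      (hB : R₁.ops.IsFrobeniusTrivial B) (hB' : R₂.ops.IsFrobeniusTrivial (Ψ.functor.obj B)) (t : ℝ),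
      R₂.δ _ hA' (picMap A ((R₁.δ A hA).symm t)) = R₂.δ _ hB' (picMap B ((R₁.δ B hB).symm t)) := by
  obtain ⟨-, hδ⟩ := h
  intro A B hA hA' hB hB' t
  rw [hδ A hA hA', hδ B hB hB', (R₁.δ A hA).apply_symm_apply, (R₁.δ B hB).apply_symm_apply]

end Literature.AlgebraicGeometry.Frobenioids

end
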